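import Literature.Analysis.ODE.SmoothDependence
import Mathlib.Analysis.SpecialFunctions.ExpDeriv
import Mathlib.Analysis.SpecialFunctions.Integrals.Basic
import HarnessLib

/-!
# Smooth dependence of solutions of forced integral equations on forcing parameters

Analysis/ODE support file (serves the provefact unit of
`Literature.MathematicalPhysics.KineticTheory.HeatConduction.CuneoEckmannHairerReyBellet2018_pinnedChain`,
second seat: differentiability of the pathwise solution of the Langevin-driven chain with respect
to finitely many forcing parameters, the deterministic core of a finite-dimensional "partial
Malliavin" argument). Everything here is PROVED; no named facts.

We consider the FORCED integral equation on `[0, 1]`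

  `α(τ) = g(x)(τ) + ∫₀^τ Y(α(s)) ds`,                                                      (IE_x)

`Y : E → E` a `C^n` field on a Banach space (`n ≥ 1`), with a forcing curve `g(x) ∈ C(I, E)`
depending in a `C^n` way on a parameter `x` of a Banach space `X` (for an additive-noise SDE
solved path by path, `g(x) = z + (0, η₀ + ∑ x_k h_k)`: initial condition plus noise path plus a
finite-dimensional perturbation of the noise).

* `Literature.Analysis.ODE.forcedRobbinMap Y g (x, α) = g x + ∫₀ (Y ∘ α) - α` — the parametric
  version of the Robbin–Lang map of `SmoothDependence.lean` (whose zeros are the solutions of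
  (IE_x); `forcedRobbinMap_eq_zero_iff`), `C^n` jointly in `(x, α)` (`contDiffAt_forcedRobbinMap`,
  from `contDiffAt_nemytskii`), with derivative `forcedRobbinDeriv`
  (`hasFDerivAt_forcedRobbinMap`), whose partial derivative in the curve variable is
  `-(1 - V_A)`, `A = DY ∘ α` (`forcedRobbinDeriv_comp_inr`), where
* `Literature.Analysis.ODE.volterraCLM A h (τ) = ∫₀^τ A(s) h(s) ds` is the **linear Volterra
  operator** of a continuous operator curve `A : C(I, E →L E)`;
* `Literature.Analysis.ODE.isUnit_one_sub_volterraCLM` — **`1 - V_A` is invertible for EVERY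
  `A`** (no smallness condition, in contrast with Lemma 1.13 of Lang / the time-scale trick of
  `SmoothDependence.lean`): Bielecki's trick — conjugating by the weight `W_L h(τ) = e^{-Lτ} h(τ)`
  (`weightCLM`, a unit `weightUnit`) gives `‖W_L V_A W_L⁻¹‖ ≤ ‖A‖/L`
  (`norm_weight_volterra_weight_le`), `< 1` for `L = 2‖A‖ + 1`, and the Neumann series applies;
  `volterra_unique`: the linear Volterra equation `w = φ + V_A w` has at most one solution;
* `Literature.Analysis.ODE.contDiffAt_forcedSolution_family` — **if (IE_x) has exactly one
  solution `S x` for every `x`, then `x ↦ S x ∈ C(I, E)` is `C^n`** (Mathlib's implicit function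
  theorem `ContDiffAt.implicitFunction` / `contDiffAt_implicitFunction` for the parametric Robbin
  map, plus uniqueness to identify the implicit function with `S`);
* `Literature.Analysis.ODE.fderiv_forcedSolution_family_eq` / `_apply` — **the variational
  equation**: `w = DS(x₀)δ` solves `w = Dg(x₀)δ + V_{DY∘S x₀} w`, i.e.
  `w(τ) = (Dg(x₀)δ)(τ) + ∫₀^τ DY(S x₀(s)) w(s) ds` (differentiate `T(x, S x) ≡ 0`).

## References

* J. W. Robbin, *On the existence theorem for differential equations*, Proc. Amer. Math. Soc.
  19 (1968), 1005–1006; S. Lang, *Differential and Riemannian Manifolds* (1995), Ch. IV §1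
  (the implicit-function-theorem proof of smooth dependence).
* A. Bielecki, *Une remarque sur la méthode de Banach–Cacciopoli–Tikhonov dans la théorie des
  équations différentielles ordinaires*, Bull. Acad. Polon. Sci. 4 (1956), 261–264 (the weighted
  norm). [folklore]

## Design choices

* Time interval fixed to `I = [0, 1]` (Mathlib's `unitInterval`), as in `SmoothDependence.lean`
  whose `nemytskii`, `applyCLM`, `primitiveCLM` are reused; consumers rescale time or, as for the
  transition probability at time `1`, need no rescaling.
* `Y` is assumed `C^n` on all of `E` (the fields of the kinetic-theory files are polynomial);
  the forcing enters through an arbitrary `C^n` map `g : X → C(I, E)`.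
* Uniqueness of solutions of (IE_x) is a HYPOTHESIS of the main theorems (supplied by Grönwall
  in applications), not reproved here.
-/

noncomputable section

open Set Metric Filter Topology Function
open scoped ContDiff

namespace Literature.Analysis.ODE

universe u

section Volterra

open unitInterval

variable {E : Type u} [NormedAddCommGroup E] [NormedSpace ℝ E]

/-! ### Exponential weights (Bielecki) and the linear Volterra operator -/

/-- The exponential weight `τ ↦ e^{-Lτ} id_E` as an element of `C(I, E →L E)`. [folklore] -/
def expWeight (L : ℝ) : C(I, E →L[ℝ] E) :=
  ⟨fun τ => Real.exp (-(L * τ)) • ContinuousLinearMap.id ℝ E, by fun_prop⟩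

/-- Unfolding `expWeight`. [folklore] -/
@[simp] theorem expWeight_apply (L : ℝ) (τ : I) (v : E) :
    expWeight L τ v = Real.exp (-(L * τ)) • v := rfl

/-- **The Bielecki weight operator** `W_L h (τ) = e^{-Lτ} h(τ)` on `C(I, E)`. [folklore] -/
def weightCLM (L : ℝ) : C(I, E) →L[ℝ] C(I, E) := applyCLM (expWeight L)

/-- Unfolding `weightCLM`. [folklore] -/
@[simp] theorem weightCLM_apply (L : ℝ) (h : C(I, E)) (τ : I) :
    weightCLM L h τ = Real.exp (-(L * τ)) • h τ := rfl

/-- `W_L ∘ W_{-L} = id`. [folklore] -/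
theorem weightCLM_comp_neg (L : ℝ) :
    (weightCLM L).comp (weightCLM (-L)) = ContinuousLinearMap.id ℝ (C(I, E)) := by
  ext h τ
  simp only [ContinuousLinearMap.comp_apply, weightCLM_apply, ContinuousLinearMap.id_apply,
    smul_smul, ← Real.exp_add]
  rw [show -(L * (τ : ℝ)) + -(-L * τ) = 0 by ring, Real.exp_zero, one_smul]

/-- `W_L` is a unit of the operator ring (inverse `W_{-L}`). [folklore] -/
def weightUnit (L : ℝ) : (C(I, E) →L[ℝ] C(I, E))ˣ where
  val := weightCLM L
  inv := weightCLM (-L)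
  val_inv := by
    rw [ContinuousLinearMap.mul_def, ContinuousLinearMap.one_def]
    exact weightCLM_comp_neg L
  inv_val := by
    rw [ContinuousLinearMap.mul_def, ContinuousLinearMap.one_def]
    simpa using weightCLM_comp_neg (E := E) (-L)

/-- `‖W_L h (τ)‖ = e^{-Lτ} ‖h τ‖`. [folklore] -/
theorem norm_weightCLM_apply (L : ℝ) (h : C(I, E)) (τ : I) :
    ‖weightCLM L h τ‖ = Real.exp (-(L * τ)) * ‖h τ‖ := by
  rw [weightCLM_apply, norm_smul, Real.norm_of_nonneg (Real.exp_nonneg _)]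

/-- **The linear Volterra operator** `V_A h (τ) = ∫₀^τ A(s) h(s) ds` of a continuous operator
curve `A : C(I, E →L E)`: the derivative in the curve variable of `α ↦ ∫₀ Y ∘ α` at a curve with
`A = DY ∘ α`. [folklore] -/
def volterraCLM (A : C(I, E →L[ℝ] E)) : C(I, E) →L[ℝ] C(I, E) := primitiveCLM.comp (applyCLM A)

/-- Unfolding `volterraCLM`. [folklore] -/
theorem volterraCLM_apply (A : C(I, E →L[ℝ] E)) (h : C(I, E)) (τ : I) :
    volterraCLM A h τ = ∫ s in (0 : ℝ)..(τ : ℝ), IccExtend zero_le_one (applyCLM A h) s := rfl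

/-- The integrand of the Volterra operator at a time `s ∈ [0, 1]` is `A(s) h(s)`. [folklore] -/
theorem IccExtend_applyCLM_of_mem (A : C(I, E →L[ℝ] E)) (h : C(I, E)) {s : ℝ} (hs : s ∈ Icc (0 : ℝ) 1) :
    IccExtend zero_le_one (applyCLM A h) s = A ⟨s, hs⟩ (h ⟨s, hs⟩) := by
  rw [IccExtend_of_mem _ _ hs]
  rfl

/-- `∫ₐᵇ e^{Ls} ds = (e^{Lb} - e^{La}) / L` for `L ≠ 0`. [folklore] -/
theorem integral_exp_const_mul {L : ℝ} (hL : L ≠ 0) (a b : ℝ) :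
    ∫ s in a..b, Real.exp (L * s) = (Real.exp (L * b) - Real.exp (L * a)) / L := by
  rw [intervalIntegral.integral_comp_mul_left (fun x => Real.exp x) hL, integral_exp, smul_eq_mul]
  field_simp

/-- **The Bielecki estimate**: conjugated by the weights, the Volterra operator is small,
`‖W_L V_A W_{-L}‖ ≤ ‖A‖ / L` for `L > 0`
(`‖e^{-Lτ} ∫₀^τ A(s) e^{Ls} h(s) ds‖ ≤ ‖A‖ ‖h‖ (1 - e^{-Lτ})/L`). [folklore] -/
theorem norm_weight_volterra_weight_le (A : C(I, E →L[ℝ] E)) {L : ℝ} (hL : 0 < L) :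
    ‖(weightCLM L).comp ((volterraCLM A).comp (weightCLM (-L)))‖ ≤ ‖A‖ / L := by
  refine ContinuousLinearMap.opNorm_le_bound _ (by positivity) fun h => ?_
  refine (ContinuousMap.norm_le _ (by positivity)).2 fun τ => ?_
  rw [ContinuousLinearMap.comp_apply, ContinuousLinearMap.comp_apply, norm_weightCLM_apply,
    volterraCLM_apply]
  have hτ0 : (0 : ℝ) ≤ τ := τ.2.1
  have hτ1 : (τ : ℝ) ≤ 1 := τ.2.2
  -- pointwise bound on the integrand
  have hbound : ∀ s ∈ Ioc (0 : ℝ) τ,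
      ‖IccExtend zero_le_one (applyCLM A (weightCLM (-L) h)) s‖ ≤ ‖A‖ * ‖h‖ * Real.exp (L * s) := by
    intro s hs
    have hsI : s ∈ Icc (0 : ℝ) 1 := ⟨hs.1.le, hs.2.trans hτ1⟩
    rw [IccExtend_applyCLM_of_mem A _ hsI, weightCLM_apply]
    calc ‖A ⟨s, hsI⟩ (Real.exp (-(-L * s)) • h ⟨s, hsI⟩)‖
        ≤ ‖A ⟨s, hsI⟩‖ * ‖Real.exp (-(-L * s)) • h ⟨s, hsI⟩‖ := ContinuousLinearMap.le_opNorm _ _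
      _ = ‖A ⟨s, hsI⟩‖ * (Real.exp (L * s) * ‖h ⟨s, hsI⟩‖) := by
          rw [norm_smul, Real.norm_of_nonneg (Real.exp_nonneg _), neg_mul, neg_neg]
      _ ≤ ‖A‖ * (Real.exp (L * s) * ‖h‖) := by
          gcongr
          · exact A.norm_coe_le_norm _
          · exact h.norm_coe_le_norm _
      _ = ‖A‖ * ‖h‖ * Real.exp (L * s) := by ring
  have hcont : Continuous fun s => ‖A‖ * ‖h‖ * Real.exp (L * s) := by fun_prop
  have hint : ‖∫ s in (0 : ℝ)..τ, IccExtend zero_le_one (applyCLM A (weightCLM (-L) h)) s‖ ≤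
      ∫ s in (0 : ℝ)..τ, ‖A‖ * ‖h‖ * Real.exp (L * s) :=
    intervalIntegral.norm_integral_le_of_norm_le hτ0 (Filter.Eventually.of_forall hbound)
      (hcont.intervalIntegrable _ _)
  rw [intervalIntegral.integral_const_mul, integral_exp_const_mul hL.ne', mul_zero, Real.exp_zero]
    at hint
  calc Real.exp (-(L * τ)) * ‖∫ s in (0 : ℝ)..τ, IccExtend zero_le_one (applyCLM A (weightCLM (-L) h)) s‖
      ≤ Real.exp (-(L * τ)) * (‖A‖ * ‖h‖ * ((Real.exp (L * τ) - 1) / L)) := by gcongr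
    _ = ‖A‖ * ‖h‖ * ((1 - Real.exp (-(L * τ))) / L) := by
        rw [Real.exp_neg]
        have hpos : Real.exp (L * τ) ≠ 0 := (Real.exp_pos _).ne'
        field_simp
    _ ≤ ‖A‖ * ‖h‖ * (1 / L) := by
        gcongr
        linarith [Real.exp_pos (-(L * τ))]
    _ = ‖A‖ / L * ‖h‖ := by ring

variable [CompleteSpace E]

/-- **The linear Volterra equation is uniquely solvable**: `1 - V_A` is a unit of the operator
ring of `C(I, E)` for EVERY continuous operator curve `A` (no smallness needed: conjugate by the
Bielecki weight `W_L` with `L = 2‖A‖ + 1`, for which `‖W_L V_A W_L⁻¹‖ ≤ 1/2`, and use the Neumann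
series). [folklore] -/
theorem isUnit_one_sub_volterraCLM (A : C(I, E →L[ℝ] E)) : IsUnit (1 - volterraCLM A) := by
  set L : ℝ := 2 * ‖A‖ + 1 with hLdef
  have hL : 0 < L := by positivity
  set W : (C(I, E) →L[ℝ] C(I, E))ˣ := weightUnit (E := E) L with hW
  set T : C(I, E) →L[ℝ] C(I, E) := ↑W * (volterraCLM A * ↑W⁻¹) with hT
  have hTeq : T = (weightCLM L).comp ((volterraCLM A).comp (weightCLM (E := E) (-L))) := rfl
  have hTn : ‖T‖ < 1 := by
    rw [hTeq]
    refine lt_of_le_of_lt (norm_weight_volterra_weight_le A hL) ?_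
    rw [div_lt_one hL, hLdef]
    linarith [norm_nonneg A]
  have hU := isUnit_one_sub_of_norm_lt_one (R := C(I, E) →L[ℝ] C(I, E)) hTn
  -- `1 - V = W⁻¹ (1 - T) W`
  have hconj : (1 - volterraCLM A) = ↑W⁻¹ * ((1 - T) * ↑W) := by
    rw [sub_mul, one_mul, mul_sub, W.inv_mul, hT, mul_assoc, mul_assoc, W.inv_mul, mul_one,
      W.inv_mul_cancel_left]
  rw [hconj]
  exact (W⁻¹.isUnit).mul (hU.mul W.isUnit)

/-- Hence `1 - V_A` is invertible as a continuous linear map, and so is `-(1 - V_A) = V_A - 1`.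
[folklore] -/
theorem isInvertible_neg_one_sub_volterraCLM (A : C(I, E →L[ℝ] E)) :
    (-(1 - volterraCLM A)).IsInvertible :=
  isInvertible_of_isUnit (isUnit_one_sub_volterraCLM A).neg

/-- **Uniqueness for the linear Volterra equation** `w = φ + V_A w`. [folklore] -/
theorem volterra_unique (A : C(I, E →L[ℝ] E)) {w₁ w₂ φ : C(I, E)} (h₁ : w₁ = φ + volterraCLM A w₁)
    (h₂ : w₂ = φ + volterraCLM A w₂) : w₁ = w₂ := by
  obtain ⟨u, hu⟩ := isUnit_one_sub_volterraCLM A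
  have e1 : (1 - volterraCLM A) w₁ = φ := by
    change w₁ - volterraCLM A w₁ = φ
    nth_rewrite 1 [h₁]
    abel
  have e2 : (1 - volterraCLM A) w₂ = φ := by
    change w₂ - volterraCLM A w₂ = φ
    nth_rewrite 1 [h₂]
    abel
  rw [← hu] at e1 e2
  exact (ContinuousLinearEquiv.ofUnit u).injective (e1.trans e2.symm)

end Volterra

/-! ### The parametric Robbin map and smooth dependence on forcing parameters -/

section Forced

open unitInterval

variable {E : Type u} [NormedAddCommGroup E] [NormedSpace ℝ E]
  {X : Type u} [NormedAddCommGroup X] [NormedSpace ℝ X]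

/-- **The parametric Robbin map** `T(x, α) = g(x) + ∫₀ (Y ∘ α) - α` on `X × C(I, E)`: its zeros
`α` are the solutions on `[0, 1]` of the forced integral equation `α(τ) = g(x)(τ) + ∫₀^τ Y(α(s)) ds`
with forcing `g(x) ∈ C(I, E)` depending on the parameter `x ∈ X` (J. Robbin, *On the existence
theorem for differential equations*, Proc. AMS 19 (1968); Lang, *Differential and Riemannian
Manifolds* (1995), Ch. IV §1, with the initial condition replaced by a forcing term).
[folklore] -/
def forcedRobbinMap (Y : E → E) (g : X → C(I, E)) (p : X × C(I, E)) : C(I, E) :=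
  g p.1 + primitiveCLM (nemytskii Y p.2) - p.2

omit [NormedAddCommGroup X] [NormedSpace ℝ X] in
/-- Zeros of the parametric Robbin map are exactly the solutions of the forced integral equation
on `[0, 1]`. [folklore] -/
theorem forcedRobbinMap_eq_zero_iff (Y : E → E) (g : X → C(I, E)) (x : X) (α : C(I, E)) :
    forcedRobbinMap Y g (x, α) = 0 ↔
      ∀ τ : I, α τ = g x τ + ∫ s in (0 : ℝ)..(τ : ℝ), IccExtend zero_le_one (nemytskii Y α) s := by
  constructor
  · intro h τ
    have := congrArg (fun f : C(I, E) => f τ) h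
    simp only [forcedRobbinMap, ContinuousMap.sub_apply, ContinuousMap.add_apply,
      primitiveCLM_apply, ContinuousMap.zero_apply] at this
    rw [sub_eq_zero] at this
    exact this.symm
  · intro h
    ext τ
    simp only [forcedRobbinMap, ContinuousMap.sub_apply, ContinuousMap.add_apply,
      primitiveCLM_apply, ContinuousMap.zero_apply, sub_eq_zero]
    exact (h τ).symm

omit [NormedSpace ℝ E] in
/-- The integrand `Y ∘ α`, extended by constants, at `s ∈ [0, 1]`. [folklore] -/
theorem IccExtend_nemytskii_of_mem {Y : E → E} (hY : Continuous Y) (α : C(I, E)) {s : ℝ}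
    (hs : s ∈ Icc (0 : ℝ) 1) : IccExtend zero_le_one (nemytskii Y α) s = Y (α ⟨s, hs⟩) := by
  rw [IccExtend_of_mem _ _ hs, nemytskii_apply (hY.comp (map_continuous α))]

/-- The parametric Robbin map of `C^n` data is `C^n` (the Nemytskii operator of a `C^n` map is
`C^n`, `contDiffAt_nemytskii`; the rest is affine continuous). [folklore] -/
theorem contDiffAt_forcedRobbinMap {n : ℕ∞} {Y : E → E} {g : X → C(I, E)} (hY : ContDiff ℝ n Y)
    (hg : ContDiff ℝ n g) (p : X × C(I, E)) : ContDiffAt ℝ n (forcedRobbinMap Y g) p := by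
  have h1 : ContDiffAt ℝ n (fun q : X × C(I, E) => nemytskii Y q.2) p :=
    (contDiffAt_nemytskii isOpen_univ hY.contDiffOn p.2 (subset_univ _)).comp p contDiffAt_snd
  unfold forcedRobbinMap
  exact ((hg.contDiffAt.comp p contDiffAt_fst).add
    ((primitiveCLM (E := E)).contDiff.contDiffAt.comp p h1)).sub contDiffAt_snd

/-- The derivative of the parametric Robbin map at `p = (x, α)`:
`(ξ, h) ↦ Dg(x) ξ + V_{DY∘α} h - h`. [folklore] -/
def forcedRobbinDeriv (Y : E → E) (g : X → C(I, E)) (p : X × C(I, E)) : X × C(I, E) →L[ℝ] C(I, E) :=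
  (fderiv ℝ g p.1).comp (ContinuousLinearMap.fst ℝ X C(I, E)) +
    (volterraCLM (nemytskii (fderiv ℝ Y) p.2)).comp (ContinuousLinearMap.snd ℝ X C(I, E)) -
      ContinuousLinearMap.snd ℝ X C(I, E)

/-- Unfolding `forcedRobbinDeriv`. [folklore] -/
@[simp] theorem forcedRobbinDeriv_apply (Y : E → E) (g : X → C(I, E)) (p : X × C(I, E))
    (q : X × C(I, E)) :
    forcedRobbinDeriv Y g p q =
      fderiv ℝ g p.1 q.1 + volterraCLM (nemytskii (fderiv ℝ Y) p.2) q.2 - q.2 := rfl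

/-- The parametric Robbin map has derivative `forcedRobbinDeriv` (chain rule with the derivative
of the Nemytskii operator, `hasFDerivAt_nemytskii`). [folklore] -/
theorem hasFDerivAt_forcedRobbinMap {n : ℕ∞} {Y : E → E} {g : X → C(I, E)} (hY : ContDiff ℝ n Y)
    (hg : ContDiff ℝ n g) (hn : 1 ≤ n) (p : X × C(I, E)) :
    HasFDerivAt (forcedRobbinMap Y g) (forcedRobbinDeriv Y g p) p := by
  have hn0 : ((n : ℕ∞) : WithTop ℕ∞) ≠ 0 := by
    have : n ≠ 0 := by rintro rfl; exact absurd hn (by simp)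
    exact_mod_cast this
  have hdiff : ∀ y ∈ (univ : Set E), HasFDerivAt Y (fderiv ℝ Y y) y := fun y _ =>
    (hY.differentiable hn0 y).hasFDerivAt
  have hYc' : ContinuousOn (fderiv ℝ Y) univ := (hY.continuous_fderiv hn0).continuousOn
  have hN : HasFDerivAt (fun q : X × C(I, E) => primitiveCLM (nemytskii Y q.2))
      ((volterraCLM (nemytskii (fderiv ℝ Y) p.2)).comp (ContinuousLinearMap.snd ℝ X C(I, E))) p :=
    (primitiveCLM (E := E)).hasFDerivAt.comp p
      ((hasFDerivAt_nemytskii isOpen_univ hdiff hYc' p.2 (subset_univ _)).comp p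
        (ContinuousLinearMap.snd ℝ X C(I, E)).hasFDerivAt)
  have hG : HasFDerivAt (fun q : X × C(I, E) => g q.1)
      ((fderiv ℝ g p.1).comp (ContinuousLinearMap.fst ℝ X C(I, E))) p :=
    ((hg.differentiable hn0) p.1).hasFDerivAt.comp p (ContinuousLinearMap.fst ℝ X C(I, E)).hasFDerivAt
  exact (hG.add hN).sub (ContinuousLinearMap.snd ℝ X C(I, E)).hasFDerivAt

/-- The partial derivative of the parametric Robbin map in the curve variable is
`-(1 - V_{DY∘α})`. [folklore] -/
theorem forcedRobbinDeriv_comp_inr (Y : E → E) (g : X → C(I, E)) (p : X × C(I, E)) :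
    (forcedRobbinDeriv Y g p).comp (ContinuousLinearMap.inr ℝ X C(I, E)) =
      -(1 - volterraCLM (nemytskii (fderiv ℝ Y) p.2)) := by
  refine ContinuousLinearMap.ext fun h => ?_
  rw [ContinuousLinearMap.comp_apply, ContinuousLinearMap.inr_apply, forcedRobbinDeriv_apply,
    map_zero, zero_add]
  change _ = -(h - volterraCLM (nemytskii (fderiv ℝ Y) p.2) h)
  abel

variable [CompleteSpace E] [CompleteSpace X]

/-- **Smooth dependence of the solution of a forced integral equation on the forcing
parameters.** Let `Y : E → E` and `g : X → C(I, E)` be `C^n`, `n ≥ 1`, and suppose that for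
every parameter `x` the forced integral equation `α = g(x) + ∫₀ Y ∘ α` has EXACTLY ONE solution
`S x ∈ C(I, E)` on `[0, 1]`. Then `x ↦ S x` is `C^n` (implicit function theorem for the
parametric Robbin map, whose partial derivative `V_{DY∘α} - 1` in `α` is always invertible,
`isUnit_one_sub_volterraCLM`). [folklore] -/
theorem contDiffAt_forcedSolution_family {n : ℕ∞} {Y : E → E} {g : X → C(I, E)}
    (hY : ContDiff ℝ n Y) (hg : ContDiff ℝ n g) (hn : 1 ≤ n) {S : X → C(I, E)}
    (hS : ∀ x, forcedRobbinMap Y g (x, S x) = 0)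
    (huniq : ∀ x α, forcedRobbinMap Y g (x, α) = 0 → α = S x) (x₀ : X) :
    ContDiffAt ℝ n S x₀ := by
  set u : X × C(I, E) := (x₀, S x₀) with hu
  have cdf : ContDiffAt ℝ n (forcedRobbinMap Y g) u := contDiffAt_forcedRobbinMap hY hg u
  have pn : ((n : ℕ∞) : WithTop ℕ∞) ≠ 0 := by
    have : n ≠ 0 := by rintro rfl; exact absurd hn (by simp)
    exact_mod_cast this
  have if₂ : (fderiv ℝ (forcedRobbinMap Y g) u ∘L .inr ℝ X C(I, E)).IsInvertible := by
    rw [(hasFDerivAt_forcedRobbinMap hY hg hn u).fderiv, forcedRobbinDeriv_comp_inr]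
    exact isInvertible_neg_one_sub_volterraCLM _
  have hψ := cdf.contDiffAt_implicitFunction pn if₂
  have hev : ∀ᶠ x in 𝓝 x₀, cdf.implicitFunction pn if₂ x = S x := by
    filter_upwards [cdf.eventually_apply_implicitFunction pn if₂] with x hx
    rw [show forcedRobbinMap Y g u = 0 from hS x₀] at hx
    exact huniq x _ hx
  exact hψ.congr_of_eventuallyEq (hev.mono fun x hx => hx.symm)

/-- **The variational equation.** Under the same hypotheses, the derivative `w = DS(x₀) δ` of the
solution family in the direction `δ` solves the LINEARISED integral equation
`w = Dg(x₀) δ + V_{DY ∘ S x₀} w`, i.e. `w(τ) = (Dg(x₀)δ)(τ) + ∫₀^τ DY(S x₀ (s)) w(s) ds`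
(differentiate the identity `T(x, S x) = 0`). [folklore] -/
theorem fderiv_forcedSolution_family_eq {n : ℕ∞} {Y : E → E} {g : X → C(I, E)}
    (hY : ContDiff ℝ n Y) (hg : ContDiff ℝ n g) (hn : 1 ≤ n) {S : X → C(I, E)}
    (hS : ∀ x, forcedRobbinMap Y g (x, S x) = 0)
    (huniq : ∀ x α, forcedRobbinMap Y g (x, α) = 0 → α = S x) (x₀ δ : X) :
    fderiv ℝ S x₀ δ =
      fderiv ℝ g x₀ δ + volterraCLM (nemytskii (fderiv ℝ Y) (S x₀)) (fderiv ℝ S x₀ δ) := by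
  have hn0 : ((n : ℕ∞) : WithTop ℕ∞) ≠ 0 := by
    have : n ≠ 0 := by rintro rfl; exact absurd hn (by simp)
    exact_mod_cast this
  have hSd : DifferentiableAt ℝ S x₀ :=
    (contDiffAt_forcedSolution_family hY hg hn hS huniq x₀).differentiableAt hn0
  have hT := hasFDerivAt_forcedRobbinMap hY hg hn (x₀, S x₀)
  have hcomp := hT.comp x₀ ((hasFDerivAt_id x₀).prodMk hSd.hasFDerivAt)
  have hzero : HasFDerivAt (forcedRobbinMap Y g ∘ fun x => (id x, S x)) (0 : X →L[ℝ] C(I, E)) x₀ := by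
    have : (forcedRobbinMap Y g ∘ fun x => (id x, S x)) = fun _ => 0 := funext fun x => hS x
    rw [this]
    exact hasFDerivAt_const 0 x₀
  have heq := congrArg (fun L : X →L[ℝ] C(I, E) => L δ) (hcomp.unique hzero)
  simp only [ContinuousLinearMap.comp_apply, ContinuousLinearMap.prod_apply,
    ContinuousLinearMap.id_apply, forcedRobbinDeriv_apply] at heq
  -- `heq : Dg δ + V w - w = 0`
  have h0 : (0 : X →L[ℝ] C(I, E)) δ = 0 := rfl
  rw [h0, sub_eq_zero] at heq
  exact heq.symm

/-- The variational equation, pointwise in time: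
`w(τ) = (Dg(x₀)δ)(τ) + ∫₀^τ DY(S x₀ (s)) w(s) ds` with `w = DS(x₀)δ`. [folklore] -/
theorem fderiv_forcedSolution_family_apply {n : ℕ∞} {Y : E → E} {g : X → C(I, E)}
    (hY : ContDiff ℝ n Y) (hg : ContDiff ℝ n g) (hn : 1 ≤ n) {S : X → C(I, E)}
    (hS : ∀ x, forcedRobbinMap Y g (x, S x) = 0)
    (huniq : ∀ x α, forcedRobbinMap Y g (x, α) = 0 → α = S x) (x₀ δ : X) (τ : I) :
    fderiv ℝ S x₀ δ τ = fderiv ℝ g x₀ δ τ +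
      ∫ s in (0 : ℝ)..(τ : ℝ), IccExtend zero_le_one
        (applyCLM (nemytskii (fderiv ℝ Y) (S x₀)) (fderiv ℝ S x₀ δ)) s := by
  have h := congrArg (fun f : C(I, E) => f τ)
    (fderiv_forcedSolution_family_eq hY hg hn hS huniq x₀ δ)
  simpa [volterraCLM_apply] using h

omit [CompleteSpace E] in
/-- The integrand of the variational equation at `s ∈ [0, 1]` is `DY(α(s)) w(s)`. [folklore] -/
theorem IccExtend_applyCLM_nemytskii_fderiv_of_mem {n : ℕ∞} {Y : E → E} (hY : ContDiff ℝ n Y)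
    (hn : 1 ≤ n) (α w : C(I, E)) {s : ℝ} (hs : s ∈ Icc (0 : ℝ) 1) :
    IccExtend zero_le_one (applyCLM (nemytskii (fderiv ℝ Y) α) w) s =
      fderiv ℝ Y (α ⟨s, hs⟩) (w ⟨s, hs⟩) := by
  have hn0 : ((n : ℕ∞) : WithTop ℕ∞) ≠ 0 := by
    have : n ≠ 0 := by rintro rfl; exact absurd hn (by simp)
    exact_mod_cast this
  rw [IccExtend_applyCLM_of_mem (nemytskii (fderiv ℝ Y) α) w hs,
    nemytskii_apply ((hY.continuous_fderiv hn0).comp (map_continuous α))]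

end Forced

end Literature.Analysis.ODE
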